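import Summits.AtomisticToContinuum.Crystallization.Theorems.FrustratedLawDichotomyFrustrationFrequency

/-!
# FrustratedLawDichotomy · crux `AperiodicFrustratedLawGap` (stmt-AtomisticToContinuum-27623) — the POSITIVE LOCAL EXCESS door
# (decomp-a2c, prover hand 1, direct share, generation 6; weakest form of the door of `FrustratedLawDichotomyFrustrationFrequency` §4)

The door `aperiodicFrustratedLawGap_of_frustrationPrice` asked for a UNIFORM price `c₁ > 0` at frustrated roots.  No uniform constant is
needed: because the frustrated roots have positive (outer) Palm frequency under the crux's hypotheses (`inv_le_prob_frustratedFineRoot`),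
POINTWISE POSITIVITY of the local excess density at frustrated roots already closes the crux.

`aperiodicFrustratedLawGap_of_positiveLocalExcess` (+ the `PeriodicChargeSplit` copy): if there is a slack `ε > 0` and a measurable
`loc ≥ 0` on rooted configurations with
* (positivity) `loc ν > 0` whenever the root of `ν` carries a two-sided `(1/8 + ε)`-fcc/hcp shell and is not robustly `1/20`-good, and
* (Theil-type local lower bound, law form) `E_P[loc] ≤ E_P[rootEnergy] − e⋆` for every point-stationary probability law a.s. carried by
  rooted `7/10`-hard-core configurations,
then `AperiodicFrustratedLawGap` holds.  Proof: for a law of the crux's class with `E_P[rootEnergy] ≤ e⋆` the bound gives `E_P[loc] = 0`,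
so `loc = 0` a.s.; but the measurable set `{loc > 0}` contains every frustrated root, hence has Palm probability `≥ 1/C(7/10, R₈ + ε) > 0`.
This is the weakest costume of the open half in the price × frequency reading: a NONNEGATIVE LOCAL EXCESS DENSITY, universal over
point-stationary hard-core laws, that does not vanish at moderately distorted close-packed sites.  All `[folklore]`.  No definitions, no `sorry`.
-/

noncomputable section

namespace Summit.AtomisticToContinuum.Crystallization.Theorems.FrustratedLawDichotomyPositiveExcessDoor

open MeasureTheory Metric Set Filter ProbabilityTheory
open scoped ENNReal
open Literature.Probability.Process
open Summit.AtomisticToContinuum.Crystallization.Theorems.FrustratedLawDichotomyFrustrationFrequency (inv_le_prob_frustratedFineRoot)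
open Summit.AtomisticToContinuum.Crystallization.Theorems.FrustratedLawDichotomyHardCoreUpgrade (aperiodicFrustratedLawGap_iff_sep07)

/-- **DOOR — `AperiodicFrustratedLawGap` from a POSITIVE LOCAL EXCESS DENSITY (no uniform price).**  A measurable `loc ≥ 0` on rooted
configurations which is positive at every frustrated root (fine up to `1/8 + ε`, not robustly `1/20`-good) and satisfies the Theil-type law
bound `E_P[loc] ≤ E_P[rootEnergy] − e⋆` for every point-stationary `7/10`-hard-core probability law implies the crux, BY NAME. [folklore] -/
theorem aperiodicFrustratedLawGap_of_positiveLocalExcess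
    (hloc : (∃ ε : ℝ, 0 < ε ∧ ∃ loc : MeasureTheory.Measure (EuclideanSpace ℝ (Fin 3)) → ℝ≥0∞, Measurable loc ∧
      (∀ ν : MeasureTheory.Measure (EuclideanSpace ℝ (Fin 3)),
          (∃ d : ℝ, (7 : ℝ) / 10 ≤ d ∧ (∀ s : EuclideanSpace ℝ (Fin 3), ν {s} ≠ 0 → s ≠ 0 → d ≤ ‖s‖ + ε) ∧
            ∃ A : EuclideanSpace ℝ (Fin 3) →ₗᵢ[ℝ] EuclideanSpace ℝ (Fin 3),
              ((∀ u ∈ Literature.Geometry.DiscreteGeometry.fccKissingPattern, ∃ s : EuclideanSpace ℝ (Fin 3), ν {s} ≠ 0 ∧ dist s (d • A u) ≤ d / 8 + ε) ∧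
                (∀ s : EuclideanSpace ℝ (Fin 3), ν {s} ≠ 0 → s ≠ 0 → ‖s‖ + ε ≤ 13 / 10 * d →
                  ∃ u ∈ Literature.Geometry.DiscreteGeometry.fccKissingPattern, dist s (d • A u) ≤ d / 8 + ε)) ∨
              ((∀ u ∈ Literature.Geometry.DiscreteGeometry.hcpKissingPattern, ∃ s : EuclideanSpace ℝ (Fin 3), ν {s} ≠ 0 ∧ dist s (d • A u) ≤ d / 8 + ε) ∧
                (∀ s : EuclideanSpace ℝ (Fin 3), ν {s} ≠ 0 → s ≠ 0 → ‖s‖ + ε ≤ 13 / 10 * d →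
                  ∃ u ∈ Literature.Geometry.DiscreteGeometry.hcpKissingPattern, dist s (d • A u) ≤ d / 8 + ε))) →
          (∀ (d η γ : ℝ) (A : EuclideanSpace ℝ (Fin 3) →ₗᵢ[ℝ] EuclideanSpace ℝ (Fin 3)),
      (∀ t : ↥Literature.Geometry.DiscreteGeometry.fccKissingPattern → EuclideanSpace ℝ (Fin 3),
        ¬ (0 < d ∧ 0 < γ ∧ η < 1 / 20 ∧
          (∀ u : ↥Literature.Geometry.DiscreteGeometry.fccKissingPattern, ν {t u} ≠ 0 ∧ ‖(t u - 0) - d • A (u : EuclideanSpace ℝ (Fin 3))‖ ≤ η * d) ∧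
          (∀ s : EuclideanSpace ℝ (Fin 3), ν {s} ≠ 0 → s ≠ 0 → d ≤ dist s 0) ∧
          (∃ s : EuclideanSpace ℝ (Fin 3), ν {s} ≠ 0 ∧ s ≠ 0 ∧ dist s 0 ≤ d) ∧
          (∀ s : EuclideanSpace ℝ (Fin 3), ν {s} ≠ 0 → s ≠ 0 → dist s 0 < 13 / 10 * d + γ → dist s 0 ≤ 13 / 10 * d - γ ∧ s ∈ Set.range t))) ∧
      (∀ t : ↥Literature.Geometry.DiscreteGeometry.hcpKissingPattern → EuclideanSpace ℝ (Fin 3),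
        ¬ (0 < d ∧ 0 < γ ∧ η < 1 / 20 ∧
          (∀ u : ↥Literature.Geometry.DiscreteGeometry.hcpKissingPattern, ν {t u} ≠ 0 ∧ ‖(t u - 0) - d • A (u : EuclideanSpace ℝ (Fin 3))‖ ≤ η * d) ∧
          (∀ s : EuclideanSpace ℝ (Fin 3), ν {s} ≠ 0 → s ≠ 0 → d ≤ dist s 0) ∧
          (∃ s : EuclideanSpace ℝ (Fin 3), ν {s} ≠ 0 ∧ s ≠ 0 ∧ dist s 0 ≤ d) ∧
          (∀ s : EuclideanSpace ℝ (Fin 3), ν {s} ≠ 0 → s ≠ 0 → dist s 0 < 13 / 10 * d + γ → dist s 0 ≤ 13 / 10 * d - γ ∧ s ∈ Set.range t)))) → 0 < loc ν) ∧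
      (∀ P : MeasureTheory.Measure (MeasureTheory.Measure (EuclideanSpace ℝ (Fin 3))), MeasureTheory.IsProbabilityMeasure P →
        (∀ᵐ μ ∂P, Literature.Probability.Process.IsRootedHardCore (7 / 10) μ) → Literature.Probability.Process.IsPointStationaryLaw P →
        ∫⁻ μ, loc μ ∂P ≤ ENNReal.ofReal ((∫ μ, Literature.MathematicalPhysics.StatisticalMechanics.rootEnergy Literature.MathematicalPhysics.StatisticalMechanics.lennardJones μ ∂P) -
          ⨅ Q : Literature.MathematicalPhysics.StatisticalMechanics.PeriodicConfiguration 3, Q.energyPerParticle Literature.MathematicalPhysics.StatisticalMechanics.lennardJones)))) :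
    Summit.AtomisticToContinuum.Crystallization.Theses.FrustratedLawDichotomy.AperiodicFrustratedLawGap := by
  obtain ⟨ε, hε, loc, hlocm, hpos, hmean⟩ := hloc
  rw [aperiodicFrustratedLawGap_iff_sep07]
  intro P
  dsimp only
  intro hP ha hb hd he h0
  obtain ⟨R₇, R₈, R₉, hd'⟩ := hd
  obtain ⟨C, hC⟩ := inv_le_prob_frustratedFineRoot (7 / 10) (by norm_num) R₈ ε hε
  have hCP := hC P
  dsimp only at hCP
  by_contra hlt
  rw [not_lt] at hlt
  -- the local lower bound forces `loc = 0` almost surely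
  have hzero : ∫⁻ μ, loc μ ∂P = 0 := by
    have h := hmean P hP ha hb
    rw [ENNReal.ofReal_eq_zero.2 (sub_nonpos.2 hlt)] at h
    exact le_zero_iff.1 h
  have hae : loc =ᵐ[P] 0 := (lintegral_eq_zero_iff hlocm).1 hzero
  have hnull : P {ν : MeasureTheory.Measure (EuclideanSpace ℝ (Fin 3)) | 0 < loc ν} = 0 := by
    refine measure_mono_null (fun ν hν => ?_) (ae_iff.1 hae)
    simp only [Set.mem_setOf_eq, Pi.zero_apply] at hν ⊢
    exact ne_of_gt hν
  -- but the frustrated roots lie in `{loc > 0}`, a measurable set of Palm probability `≥ 1/C`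
  have hA : MeasurableSet {ν : MeasureTheory.Measure (EuclideanSpace ℝ (Fin 3)) | 0 < loc ν} := measurableSet_lt measurable_const hlocm
  have hfreq : (C : ℝ≥0∞)⁻¹ ≤ P {ν : MeasureTheory.Measure (EuclideanSpace ℝ (Fin 3)) | 0 < loc ν} :=
    hCP hP ha hb R₇ R₉ hd' _ hA (fun ν hF hN => hpos ν hF hN)
  rw [hnull, nonpos_iff_eq_zero, ENNReal.inv_eq_zero] at hfreq
  exact ENNReal.natCast_ne_top C hfreq

/-- The same door for the `PeriodicChargeSplit` copy of the shared crux decl. [folklore] -/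
theorem periodicChargeSplit_aperiodicFrustratedLawGap_of_positiveLocalExcess
    (hloc : (∃ ε : ℝ, 0 < ε ∧ ∃ loc : MeasureTheory.Measure (EuclideanSpace ℝ (Fin 3)) → ℝ≥0∞, Measurable loc ∧
      (∀ ν : MeasureTheory.Measure (EuclideanSpace ℝ (Fin 3)),
          (∃ d : ℝ, (7 : ℝ) / 10 ≤ d ∧ (∀ s : EuclideanSpace ℝ (Fin 3), ν {s} ≠ 0 → s ≠ 0 → d ≤ ‖s‖ + ε) ∧
            ∃ A : EuclideanSpace ℝ (Fin 3) →ₗᵢ[ℝ] EuclideanSpace ℝ (Fin 3),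
              ((∀ u ∈ Literature.Geometry.DiscreteGeometry.fccKissingPattern, ∃ s : EuclideanSpace ℝ (Fin 3), ν {s} ≠ 0 ∧ dist s (d • A u) ≤ d / 8 + ε) ∧
                (∀ s : EuclideanSpace ℝ (Fin 3), ν {s} ≠ 0 → s ≠ 0 → ‖s‖ + ε ≤ 13 / 10 * d →
                  ∃ u ∈ Literature.Geometry.DiscreteGeometry.fccKissingPattern, dist s (d • A u) ≤ d / 8 + ε)) ∨
              ((∀ u ∈ Literature.Geometry.DiscreteGeometry.hcpKissingPattern, ∃ s : EuclideanSpace ℝ (Fin 3), ν {s} ≠ 0 ∧ dist s (d • A u) ≤ d / 8 + ε) ∧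
                (∀ s : EuclideanSpace ℝ (Fin 3), ν {s} ≠ 0 → s ≠ 0 → ‖s‖ + ε ≤ 13 / 10 * d →
                  ∃ u ∈ Literature.Geometry.DiscreteGeometry.hcpKissingPattern, dist s (d • A u) ≤ d / 8 + ε))) →
          (∀ (d η γ : ℝ) (A : EuclideanSpace ℝ (Fin 3) →ₗᵢ[ℝ] EuclideanSpace ℝ (Fin 3)),
      (∀ t : ↥Literature.Geometry.DiscreteGeometry.fccKissingPattern → EuclideanSpace ℝ (Fin 3),
        ¬ (0 < d ∧ 0 < γ ∧ η < 1 / 20 ∧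
          (∀ u : ↥Literature.Geometry.DiscreteGeometry.fccKissingPattern, ν {t u} ≠ 0 ∧ ‖(t u - 0) - d • A (u : EuclideanSpace ℝ (Fin 3))‖ ≤ η * d) ∧
          (∀ s : EuclideanSpace ℝ (Fin 3), ν {s} ≠ 0 → s ≠ 0 → d ≤ dist s 0) ∧
          (∃ s : EuclideanSpace ℝ (Fin 3), ν {s} ≠ 0 ∧ s ≠ 0 ∧ dist s 0 ≤ d) ∧
          (∀ s : EuclideanSpace ℝ (Fin 3), ν {s} ≠ 0 → s ≠ 0 → dist s 0 < 13 / 10 * d + γ → dist s 0 ≤ 13 / 10 * d - γ ∧ s ∈ Set.range t))) ∧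
      (∀ t : ↥Literature.Geometry.DiscreteGeometry.hcpKissingPattern → EuclideanSpace ℝ (Fin 3),
        ¬ (0 < d ∧ 0 < γ ∧ η < 1 / 20 ∧
          (∀ u : ↥Literature.Geometry.DiscreteGeometry.hcpKissingPattern, ν {t u} ≠ 0 ∧ ‖(t u - 0) - d • A (u : EuclideanSpace ℝ (Fin 3))‖ ≤ η * d) ∧
          (∀ s : EuclideanSpace ℝ (Fin 3), ν {s} ≠ 0 → s ≠ 0 → d ≤ dist s 0) ∧
          (∃ s : EuclideanSpace ℝ (Fin 3), ν {s} ≠ 0 ∧ s ≠ 0 ∧ dist s 0 ≤ d) ∧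
          (∀ s : EuclideanSpace ℝ (Fin 3), ν {s} ≠ 0 → s ≠ 0 → dist s 0 < 13 / 10 * d + γ → dist s 0 ≤ 13 / 10 * d - γ ∧ s ∈ Set.range t)))) → 0 < loc ν) ∧
      (∀ P : MeasureTheory.Measure (MeasureTheory.Measure (EuclideanSpace ℝ (Fin 3))), MeasureTheory.IsProbabilityMeasure P →
        (∀ᵐ μ ∂P, Literature.Probability.Process.IsRootedHardCore (7 / 10) μ) → Literature.Probability.Process.IsPointStationaryLaw P →
        ∫⁻ μ, loc μ ∂P ≤ ENNReal.ofReal ((∫ μ, Literature.MathematicalPhysics.StatisticalMechanics.rootEnergy Literature.MathematicalPhysics.StatisticalMechanics.lennardJones μ ∂P) -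
          ⨅ Q : Literature.MathematicalPhysics.StatisticalMechanics.PeriodicConfiguration 3, Q.energyPerParticle Literature.MathematicalPhysics.StatisticalMechanics.lennardJones)))) :
    Summit.AtomisticToContinuum.Crystallization.Theses.PeriodicChargeSplit.AperiodicFrustratedLawGap :=
  aperiodicFrustratedLawGap_of_positiveLocalExcess hloc

end Summit.AtomisticToContinuum.Crystallization.Theorems.FrustratedLawDichotomyPositiveExcessDoor

end
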